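/-
Copyright: statement-level skeleton of a published paper (lit-balaban cell, Phase-2 proof seat p19, gen 4). No claims beyond
what the kernel checks below.
-/
import Mathlib
import Literature.MathematicalPhysics.QuantumFieldTheory.Balaban1983to89.B3Prop21Except24Family
import Literature.MathematicalPhysics.QuantumFieldTheory.Balaban1983to89.B3Prop21Except24Ordering

/-!
# B3 — T. Bałaban, *(Higgs)₂,₃ quantum fields in a finite volume. III. Renormalization*, CMP **88** (1983) 411–445
[Balaban1983Higgs3] — Proposition 2.1 p. 424 WITH THE (2.4) EXCEPTION: r15's `B3Prop1.Prop21` INHABITED for the multi-graph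
expansions of the IBP-ready amplitude model, `Is24 :=` "the block is a (2.4)-block", O(1) uniform in the graph

statement-level skeleton of published theorems with citation tags; proofs where landed; nothing here is a claim about
the Yang–Mills mass gap

PDF held: `paper:balaban1983-higgs-2-3-quantum-fields-finite-volume` (journal page = PDF page + 410); displays and sentences
of pp. 420–421, 424–428 read on the ×2 renders `pub-balaban/b2b-balaban-ref1/pages/1983-cmp88-higgs23-III/
1983-cmp88-higgs23-III-p010, p011, p014 … p018-x2.png`.

Part of the Phase-2 work on SKELETON rows **B3.Prop2.1 / B3.Prop2.2** (unit `lit-balaban-p19` gen 4, HOME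
`run/shared/lean/pub/lit-balaban/`): the last file of the (2.4) EXCEPTION of Proposition 2.1 (`B3LatticeIBP` → `B3AmpIBP` →
`B3AmpIBPClosed` → `B3AmpIBPAll` → `B3IBPSites` → `B3IBPDegrees`, `B3IBPKernelBounds` → `B3AmpIBPBounds` →
`B3Prop21Except24Family`, `B3Prop21Except24Ordering` → this file), completing
`B3Prop21Instance` (gen 3: one count datum, `Is24 := False`) and `B3Prop21Uniform` (gen 4: O(1) uniform, `Is24 := False`).

WHAT IS REPRODUCED.  Proposition 2.1 p. 424 [PDF 14], verbatim: *"Let G be a connected graph such that its each connected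
subgraph, with the possible exception of the subgraphs (2.4), has a positive degree. Then we define G_ren = {G} and
Proposition 1 holds in this case."*, with its printed proof pp. 424–428: (2.6)/(2.7) (decomposition of the propagators, sum
over the orderings l̃ — `B3Prop21Model`, r15's `B3.display27`), the integration by parts (2.8)/(2.9) at the subgraphs (2.4)
along each ordering (*"this way we represent G′ as a sum of graphs {G′∗} … for each graph G′∗ the subgraphs G₁, G₂, …, G_m =
G′∗ defined as previously have positive degrees"* — `B3AmpIBPAll`, `B3IBPDegrees`, `B3AmpIBPBounds`), the first estimate (2.13)
(`B3Ineq213Proof`) and (2.15) (`B3Ineq215Proof`) for each `G′∗`, with *"O(1) depending on n̄ and δ₁ only"* (`B3Prop21Uniform`).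
KERNEL-CHECKED HERE: **`prop21_except24 : B3Prop1.Prop21 (famIBP P mbar)`** for the family of MULTI-GRAPH EXPANSIONS
`expansionIBP P mb D` of r15's carrier (defined in `B3Prop21Except24Family`) — graphs = all CONNECTED count data on the vertex sets `Fin n` with at most `mb = mbar n̄`
lines and the lattice constants of `P` (`CGraphC`), analytic datum `D` = `k`, the running couplings, and for every such graph AND
LOCALIZATION
`{□(v)}` an IBP-ready amplitude (`B3AmpIBPBounds.IBPAmp`: vertex functions, kernels with (2.10) and its derivative budget, the
undifferentiated kernels `K♭`, constants `≤ Cmax`, `cD ≤ CD`), `E(G, {□(v)}, Φ, A)` = its total amplitude `Amp.Etot`, connected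
subgraphs = the components of the `G_i` along every ordering with their degrees `degQ`, and **`Is24 G ⟨l̃, i, b⟩ :=
Is24Block (G along l̃) i b`** — the component is a single line of (2.4)-shape (two endpoints, the derivative leg contracted
into the line) of degree `0` (`B3IBPSites.Is24Block`): δ₀ := ½δ₁ first; given α₀, n̄ ONE constant `O(1)(n̄) = unifO1x P (mbar n̄)`
(a function of `n̄`, `d`, `L`, `δ₁`, `Cmax`, `CD` only); then for every datum and every graph satisfying the PRINTED hypothesis
`PosSubgraphsExcept24` (every component has positive degree OR is a (2.4)-block), (1.33) for all localizations and external
fields — via `B3Prop21Except24Ordering.abs_Etot_le_except24`.  Also `prop22_except24`.  NON-VACUITY (in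
`B3Prop21Except24Family`): the index type is inhabited (`DatumIBP.zero`) — unlike `B3Prop21Uniform.Datum`, which is EMPTY
(`datum_isEmpty`), so that `B3Prop21Uniform.prop21_uniform` holds vacuously; the present family, indexed over connected graphs,
is the corrected uniform statement as well; the graph (2.4) itself is a member satisfying the hypothesis
(`B3Prop21Except24Member`).  HONEST SCOPE: the analytic inputs ((2.5), (2.10)–(2.12), their derivative budget, the IBP-readiness
`K_l = ∂⁺K♭_l`, the face-vanishing smooth localization) are hypotheses of the class `IBPAmp`, not derived from Propositions
I.2.1/I.2.3; the integration by parts is performed at every isolated differentiated line along the ordering (a superset of the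
(2.4)-blocks, harmless for the others); the subgraph family is the one the printed proof uses (components of the `G_i`).
-/

open Finset

namespace Literature.MathematicalPhysics.QuantumFieldTheory.Balaban1983to89.B3Ineq213

open B3Ineq215 B3Sect2FirstEstimate B3Prop1

variable {V : Type} [Fintype V] [DecidableEq V] {m : ℕ}

/-! ## Proposition 2.1 with the (2.4) exception, O(1) uniform in the graph -/

/-- The per-size term of the uniform constant: `m!·(m+1)^m·(|Cmax|(1+e^{δ₁})²)^m·unifConst215·|CD|^m`.
[cite: Balaban1983Higgs3, Prop. 1 p.421] -/
noncomputable def sizeTermX (P : ParamsIBP) (m : ℕ) : ℝ :=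
  (m.factorial : ℝ) * ((m + 1) ^ m : ℕ)
    * ((|P.Cmax| ^ m * ((1 + Real.exp (2 * (P.δ₁ / 2))) ^ 2) ^ m) * unifConst215 P.d P.L m P.δ₁ * |P.CD| ^ m)

/-- `sizeTermX ≥ 0`. [cite: Balaban1983Higgs3, Prop. 1 p.421] -/
theorem sizeTermX_nonneg (P : ParamsIBP) (m : ℕ) : 0 ≤ sizeTermX P m := by
  unfold sizeTermX
  have := (unifConst215_pos P.d_pos P.two_le_L m P.δ₁_pos).le
  positivity

/-- **The uniform constant O(1)(n̄)** at the size bound `mb`: `max 1 (Σ_{m ≤ mb} sizeTermX m)`. [cite: Balaban1983Higgs3, Prop. 1 p.421] -/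
noncomputable def unifO1x (P : ParamsIBP) (mb : ℕ) : ℝ := max 1 (∑ m ∈ range (mb + 1), sizeTermX P m)

/-- `unifO1x > 0`. [cite: Balaban1983Higgs3, Prop. 1 p.421] -/
theorem unifO1x_pos (P : ParamsIBP) (mb : ℕ) : 0 < unifO1x P mb := lt_max_of_lt_left one_pos

/-- Each size term is dominated by the uniform constant. [cite: Balaban1983Higgs3, Prop. 1 p.421] -/
theorem sizeTermX_le_unifO1x (P : ParamsIBP) {mb m : ℕ} (hm : m ≤ mb) : sizeTermX P m ≤ unifO1x P mb :=
  (single_le_sum (f := sizeTermX P) (fun m _ => sizeTermX_nonneg P m) (mem_range.2 (Nat.lt_succ_of_le hm))).trans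
    (le_max_right _ _)

/-- **Proposition 2.1 with the (2.4) exception — r15's `B3Prop1.Prop21` INHABITED for the multi-graph expansions of the IBP-ready
amplitudes**: with `δ₀ := ½δ₁` (first) and, given α₀ and n̄, the single constant `O(1)(n̄) := unifO1x P (mbar n̄)`, (1.33) holds
for the class `{G}` of EVERY graph with at most `mbar n̄` lines all of whose components (of the `G_i`, every ordering) have positive
degree OR ARE (2.4)-BLOCKS, for every analytic datum, all localizations and all external-field data — by (2.6)/(2.7), the
integration by parts (2.8)/(2.9) at the (2.4)-blocks of each ordering, (2.13) and (2.15) for each graph `G′∗`.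
[cite: Balaban1983Higgs3, Prop. 2.1 p.424] -/
theorem prop21_except24 (P : ParamsIBP) (mbar : ℕ → ℕ) : Prop21 (famIBP P mbar) := by
  classical
  refine ⟨P.δ₁ / 2, half_pos P.δ₁_pos, fun α₀ _ _ nbar => ?_⟩
  refine ⟨unifO1x P (mbar nbar), unifO1x_pos P (mbar nbar), fun D G hG => ?_⟩
  intro box Φ Aext
  change Fin G.n → Fin G.G.toModel.d → ℕ at box
  set A : IBPAmp G.G := D.amp G.G G.conn box with hA
  have hyp := fun σ => hyp_of_posSubgraphsExcept24 hG σ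
  have hmain := A.abs_Etot_le_except24 hyp
  -- the constants
  have hE : Esh G.G.toModel = Real.exp (2 * (P.δ₁ / 2)) := by
    show Real.exp (2 * (G.G.δ₁ / 2)) = _
    rw [G.δ₁_eq]
  have hC : ∏ l, A.C l ≤ |P.Cmax| ^ G.m := by
    calc ∏ l, A.C l ≤ ∏ _l : Fin G.m, |P.Cmax| :=
          prod_le_prod (fun l _ => A.C_nonneg l) fun l _ => (D.amp_C_le G.G G.conn box l).trans (le_abs_self _)
      _ = |P.Cmax| ^ G.m := by rw [prod_const, card_univ, Fintype.card_fin]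
  have hcD : A.cD ^ G.m ≤ |P.CD| ^ G.m :=
    pow_le_pow_left₀ (le_trans zero_le_one A.one_le_cD) ((D.amp_cD_le G.G G.conn box).trans (le_abs_self _)) _
  have hU0 : 0 ≤ unifConst215 P.d P.L G.m P.δ₁ := (unifConst215_pos P.d_pos P.two_le_L G.m P.δ₁_pos).le
  have hpref : 0 ≤ A.toAmp.pref := A.toAmp.pref_nonneg
  have hK : (G.m.factorial : ℝ) * ((G.m + 1) ^ G.m : ℕ)
      * (((∏ l, A.C l) * ((1 + Esh G.G.toModel) ^ 2) ^ G.m) * unifConst215 G.G.d G.G.L G.m G.G.δ₁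
        * (A.cD ^ G.m * A.toAmp.pref)) ≤ sizeTermX P G.m * A.toAmp.pref := by
    rw [G.d_eq, G.L_eq, G.δ₁_eq, hE]
    unfold sizeTermX
    have h1 : (∏ l, A.C l) * ((1 + Real.exp (2 * (P.δ₁ / 2))) ^ 2) ^ G.m
        ≤ |P.Cmax| ^ G.m * ((1 + Real.exp (2 * (P.δ₁ / 2))) ^ 2) ^ G.m :=
      mul_le_mul_of_nonneg_right hC (pow_nonneg (sq_nonneg _) _)
    have h0 : 0 ≤ (∏ l, A.C l) * ((1 + Real.exp (2 * (P.δ₁ / 2))) ^ 2) ^ G.m :=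
      mul_nonneg (prod_nonneg fun l _ => A.C_nonneg l) (pow_nonneg (sq_nonneg _) _)
    have h2 : (∏ l, A.C l) * ((1 + Real.exp (2 * (P.δ₁ / 2))) ^ 2) ^ G.m * unifConst215 P.d P.L G.m P.δ₁ * A.cD ^ G.m
        ≤ |P.Cmax| ^ G.m * ((1 + Real.exp (2 * (P.δ₁ / 2))) ^ 2) ^ G.m * unifConst215 P.d P.L G.m P.δ₁ * |P.CD| ^ G.m :=
      mul_le_mul (mul_le_mul_of_nonneg_right h1 hU0) hcD (pow_nonneg (le_trans zero_le_one A.one_le_cD) _)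
        (mul_nonneg (mul_nonneg (pow_nonneg (abs_nonneg _) _) (pow_nonneg (sq_nonneg _) _)) hU0)
    have hf : 0 ≤ (G.m.factorial : ℝ) * ((G.m + 1) ^ G.m : ℕ) := by positivity
    calc (G.m.factorial : ℝ) * ((G.m + 1) ^ G.m : ℕ)
          * (((∏ l, A.C l) * ((1 + Real.exp (2 * (P.δ₁ / 2))) ^ 2) ^ G.m) * unifConst215 P.d P.L G.m P.δ₁
            * (A.cD ^ G.m * A.toAmp.pref))
        = (G.m.factorial : ℝ) * ((G.m + 1) ^ G.m : ℕ)
          * (((∏ l, A.C l) * ((1 + Real.exp (2 * (P.δ₁ / 2))) ^ 2) ^ G.m) * unifConst215 P.d P.L G.m P.δ₁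
            * A.cD ^ G.m) * A.toAmp.pref := by ring
      _ ≤ (G.m.factorial : ℝ) * ((G.m + 1) ^ G.m : ℕ)
          * (|P.Cmax| ^ G.m * ((1 + Real.exp (2 * (P.δ₁ / 2))) ^ 2) ^ G.m * unifConst215 P.d P.L G.m P.δ₁ * |P.CD| ^ G.m)
          * A.toAmp.pref :=
          mul_le_mul_of_nonneg_right (mul_le_mul_of_nonneg_left h2 hf) hpref
      _ = _ := by ring
  have hfin : |A.toAmp.Etot| ≤ unifO1x P (mbar nbar) * A.toAmp.pref :=
    (hmain.trans hK).trans (mul_le_mul_of_nonneg_right (sizeTermX_le_unifO1x P G.m_le) hpref)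
  -- assemble in the shape of `Ineq133At`
  show |A.toAmp.Etot| ≤ unifO1x P (mbar nbar) * D.eRun ^ (∑ v, (D.amp G.G G.conn box₀).dv v)
      * D.lamRun ^ (∑ v, (D.amp G.G G.conn box₀).ds v) * Real.exp (-(P.δ₁ / 2 * boxTreeLen G.G.L D.k box))
      * (∏ v, A.NPhi v) * (∏ v, A.NA v)
  have e : A.toAmp.pref = D.eRun ^ (∑ v, (D.amp G.G G.conn box₀).dv v) * D.lamRun ^ (∑ v, (D.amp G.G G.conn box₀).ds v)
      * Real.exp (-(P.δ₁ / 2 * boxTreeLen G.G.L D.k box)) * (∏ v, A.NPhi v) * (∏ v, A.NA v) := by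
    have hb : A.box = box := D.amp_box G.G G.conn box
    have hk : A.k = D.k := D.amp_k G.G G.conn box
    have he : A.eRun = D.eRun := D.amp_eRun G.G G.conn box
    have hl : A.lamRun = D.lamRun := D.amp_lamRun G.G G.conn box
    have hdv : A.dv = (D.amp G.G G.conn box₀).dv := D.amp_dv G.G G.conn box box₀
    have hds : A.ds = (D.amp G.G G.conn box₀).ds := D.amp_ds G.G G.conn box box₀
    unfold Amp.pref
    rw [hb, hk, he, hl, hdv, hds, G.δ₁_eq]
  calc |A.toAmp.Etot| ≤ unifO1x P (mbar nbar) * A.toAmp.pref := hfin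
    _ = _ := by rw [e]; ring

/-- The same family inhabits r15's `B3Prop1.Prop22` (the amplitudes ARE in Proposition 2.2 generality). [cite: Balaban1983Higgs3, Prop. 2.2 p.428] -/
theorem prop22_except24 (P : ParamsIBP) (mbar : ℕ → ℕ) : Prop22 (famIBP P mbar) :=
  prop21_except24 P mbar

end Literature.MathematicalPhysics.QuantumFieldTheory.Balaban1983to89.B3Ineq213
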